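import Literature.Probability.LatticeModels.PlaneRotatorChainTwoPoint
import Literature.Probability.LatticeModels.PlaneRotatorStrandDecoupling
import HarnessLib

/-!
# The quasi-one-dimensional ordering criterion for the classical XY chain array, explicit form:
# `⟨cos(θ_a − θ_c)⟩_Λ ≤ (2βJ⊥ · (1 + u)/(1 − u))^{d⊥(a,c)}`, `u = I₁(βJ∥)/I₀(βJ∥)`

Topic `Literature/Probability/LatticeModels`. The strand-decoupling lemma `twoPoint_layered_le_pow_transverse`
(`PlaneRotatorStrandDecoupling.lean`) turns any uniform ceiling `χ₁` on the susceptibility of ONE chain of the array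
`layeredXYCoupling β Jp Jz Λ` (chains along the stacking axis, `Jz = J∥`; transverse coupling `Jp = J⊥`) into
transverse exponential decay at rate `2βJ⊥χ₁`. Here the ceiling is made explicit and uniform in the volume: every chain
of `Λ` (the sites of one strand, possibly with gaps) is a sub-system of the open reference chain
`chainCoupling N (βJ∥)` (`PlaneRotatorChainTwoPoint.lean`) under the Griffiths–Ginibre comparison
`twoPoint_le_of_injOn` (`PlaneRotatorShellDecay.lean`), so `χ₁ ≤ (1 + u)/(1 − u)`, `u = u(βJ∥) = I₁/I₀ < 1` at EVERY
temperature (`sum_twoPoint_chain_le`). Results: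

* `sum_twoPoint_onStrand_le` — the single-strand susceptibility of the array is at most `(1+u(βJ∥))/(1−u(βJ∥))`,
  uniformly in `Λ` and in the site;
* `twoPoint_layered_le_pow_transverse_besselRatio` — **the quasi-1D criterion**: for `β, J⊥, J∥ ≥ 0`, every finite
  `Λ ⊂ ℤ³` and all `a, c ∈ Λ`,
  `⟨cos(θ_a − θ_c)⟩_Λ ≤ (2βJ⊥ (1+u)/(1−u))^{|a₀−c₀|+|a₁−c₁|}`, `u = u(βJ∥)`;
* `one_add_besselRatio_div_le`, `twoPoint_layered_le_pow_transverse_amos`, `…_of_sq_le` — the closed form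
  `(1+u)/(1−u) ≤ (√(K²+4) + K)²/4` (Amos) and the resulting Bessel-free / `norm_num`-decidable criteria.

Reading: whenever `2(J⊥/T)·(1+u(J∥/T))/(1−u(J∥/T)) < 1` the array has no transverse — hence no — long-range order
at temperature `T`, uniformly in the volume: `k_BT_c^{q1D-XY}(J∥, J⊥) ≤ T₀(J∥, J⊥)`, the root of
`2(J⊥/T₀)(1+u)/(1−u) = 1`. Since `(1+u(K))/(1−u(K)) ~ 4K` (`K → ∞`), `T₀ ~ 2√2·√(J∥J⊥)` as `J⊥/J∥ → 0`: the
Scalapino–Imry–Pincus quasi-one-dimensional scale as a ONE-SIDED theorem (the Lieb star criterion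
`2u(βJ∥) + 4u(βJ⊥) < 1` and the mean-field bound stay at `T ≈ J∥` in that limit). The transcendental constant
`u(βJ∥)` is left symbolic (certified enclosures of `I₁/I₀` are the cell's numerics lane, as for Lieb's box numbers).
HONEST FRAMING: classical rotators, finite volume, free boundary conditions, upper bounds; cell `pub/hubbard-tc`
(MO-S3) key K5 reading only («certified chain/ladder stiffness word ⇒ ceiling on the 3D ordering temperature of
weakly coupled chains», hold-out M38); no statement about quantum ladders.

References: E. H. Lieb, Comm. Math. Phys. **77** (1980) 127, Theorem 4, eqs. (23), (25) [Lieb1980]; J. Ginibre,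
Comm. Math. Phys. **16** (1970) 310, Prop. 3 / Example 4 [Ginibre1970]; M. Aizenman, B. Simon, Comm. Math. Phys.
**77** (1980) 137, Thm 3.2 / Remark 4 [AizenmanSimon1980LocalWard]; D. E. Amos, Math. Comp. **28** (1974) 239,
eq. (11) [Amos1974].
-/

noncomputable section

open MeasureTheory Finset
open scoped BigOperators

namespace Literature.Probability.LatticeModels

namespace PlaneRotator

section Quasi1D

open Literature.Barriers.CriticalPhenomena Literature.Barriers.CriticalPhenomena.LongRangeIsing

variable {β Jp Jz : ℝ} [MeasurableSpace Circle] [BorelSpace Circle]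

omit [MeasurableSpace Circle] [BorelSpace Circle] in
/-- Two sites on the same strand with the same third coordinate coincide. [folklore] -/
private theorem eq_of_strand_eq_of_apply_two_eq {Λ : Finset (Site 3)} {x y : Λ} (hs : strand x = strand y)
    (h2 : (x : Site 3) 2 = (y : Site 3) 2) : x = y := by
  have h0 : (x : Site 3) 0 = (y : Site 3) 0 := congrArg Prod.fst hs
  have h1 : (x : Site 3) 1 = (y : Site 3) 1 := congrArg Prod.snd hs
  apply Subtype.ext
  funext i
  fin_cases i
  · exact h0
  · exact h1
  · exact h2

omit [MeasurableSpace Circle] [BorelSpace Circle] in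
/-- An axial bond of the array between two sites of one strand: the sites differ by `±1` in the third coordinate and
the coupling is `βJ∥/2` (per orientation). [cite: LiuStanley1972, p. 272 (layers (J, J, εJ))] -/
private theorem onStrand_layeredXYCoupling_ne_zero {Λ : Finset (Site 3)} {s : ℤ × ℤ} {y z : Λ}
    (h : onStrand (layeredXYCoupling β Jp Jz Λ) s (y, z) ≠ 0) :
    strand y = s ∧ strand z = s ∧ (((y : Site 3) 2 - (z : Site 3) 2).natAbs = 1) ∧
      onStrand (layeredXYCoupling β Jp Jz Λ) s (y, z) = β / 2 * Jz := by
  have hcond : strand y = s ∧ strand z = s := by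
    by_contra hh; exact h (if_neg hh)
  have hJ : layeredXYCoupling β Jp Jz Λ (y, z) ≠ 0 := by
    intro hh; apply h; unfold onStrand; rw [if_pos hcond]; exact hh
  have hnn := layeredXYCoupling_nn Λ (y, z) hJ
  have hsum : (((y : Site 3) 0 - (z : Site 3) 0)).natAbs + (((y : Site 3) 1 - (z : Site 3) 1)).natAbs +
      (((y : Site 3) 2 - (z : Site 3) 2)).natAbs = 1 := by
    have h' := hnn
    unfold l1Norm at h'
    rw [Fin.sum_univ_three] at h'
    simpa only [Pi.sub_apply] using h'
  have h0 : (y : Site 3) 0 = (z : Site 3) 0 := by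
    have := congrArg Prod.fst (hcond.1.trans hcond.2.symm); exact this
  have h1 : (y : Site 3) 1 = (z : Site 3) 1 := by
    have := congrArg Prod.snd (hcond.1.trans hcond.2.symm); exact this
  have h0' : (((y : Site 3) 0 - (z : Site 3) 0)).natAbs = 0 := by rw [h0, sub_self, Int.natAbs_zero]
  have h1' : (((y : Site 3) 1 - (z : Site 3) 1)).natAbs = 0 := by rw [h1, sub_self, Int.natAbs_zero]
  have h2 : (((y : Site 3) 2 - (z : Site 3) 2)).natAbs = 1 := by omega
  refine ⟨hcond.1, hcond.2, h2, ?_⟩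
  have hne : ((y : Site 3) - (z : Site 3)) 2 ≠ 0 := by
    rw [Pi.sub_apply]; intro h0; rw [h0, Int.natAbs_zero] at h2; exact absurd h2 (by norm_num)
  unfold onStrand layeredXYCoupling layeredCoupling
  rw [if_pos hcond, if_pos hnn, if_neg hne]

/-- **The single-strand susceptibility of the chain array is bounded by the open-chain value, uniformly in the
volume**: for `β, J⊥, J∥ ≥ 0`, every finite `Λ ⊂ ℤ³` and every site `a`,
`∑_{x ∈ chain(a)} ⟨cos(θ_a − θ_x)⟩^{1D}_{chain(a)} ≤ (1 + u(βJ∥))/(1 − u(βJ∥))`. The chain of `a` inside `Λ` (a finite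
subset of a line, possibly with gaps) embeds into the open reference chain `chainCoupling N (βJ∥)` on a window of
`N + 1` consecutive heights with dominated couplings, so Griffiths–Ginibre (`twoPoint_le_of_injOn`) and the chain
bound `sum_twoPoint_chain_le` apply. [cite: Ginibre1970, Prop. 3 with Example 4 (plane rotators; sub-systems)] -/
theorem sum_twoPoint_onStrand_le (hβ : 0 ≤ β) (hp : 0 ≤ Jp) (hz : 0 ≤ Jz) (Λ : Finset (Site 3)) (a : Λ) :
    ∑ x ∈ univ.filter (fun x : Λ => strand x = strand a),
        twoPoint (onStrand (layeredXYCoupling β Jp Jz Λ) (strand a)) a x ≤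
      (1 + besselRatio (β * Jz)) / (1 - besselRatio (β * Jz)) := by
  classical
  set J := layeredXYCoupling β Jp Jz Λ with hJ
  have hJ0 : ∀ p, 0 ≤ J p := layeredXYCoupling_nonneg hβ hp hz Λ
  set s := strand a with hs
  set A : Finset Λ := univ.filter (fun x : Λ => strand x = s) with hA
  -- the window of heights `[z₀ - B, z₀ + B]` containing `Λ`
  set z₀ : ℤ := (a : Site 3) 2 with hz₀
  set B : ℕ := Λ.sup (fun x : Site 3 => (x 2 - z₀).natAbs) with hB
  have hBx : ∀ x : Λ, (((x : Site 3) 2) - z₀).natAbs ≤ B := fun x =>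
    Finset.le_sup (f := fun x : Site 3 => (x 2 - z₀).natAbs) x.2
  set N : ℕ := 2 * B with hN
  have hwin : ∀ x : Λ, 0 ≤ ((x : Site 3) 2) - z₀ + B ∧ ((x : Site 3) 2) - z₀ + B ≤ N := by
    intro x
    have h := hBx x
    constructor <;> omega
  -- the embedding into the reference chain
  set τ : Λ → Fin (N + 1) := fun x => ⟨(((x : Site 3) 2) - z₀ + B).toNat, by
    have h := hwin x; omega⟩ with hτ
  have hτval : ∀ x : Λ, ((τ x : ℕ) : ℤ) = ((x : Site 3) 2) - z₀ + B := fun x => by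
    simp only [hτ]
    exact Int.toNat_of_nonneg (hwin x).1
  have hinj : Set.InjOn τ A := by
    intro x hx y hy hxy
    simp only [hA, Finset.coe_filter, Finset.mem_univ, true_and, Set.mem_setOf_eq] at hx hy
    have hv : ((τ x : ℕ) : ℤ) = ((τ y : ℕ) : ℤ) := by rw [hxy]
    rw [hτval, hτval] at hv
    exact eq_of_strand_eq_of_apply_two_eq (hx.trans hy.symm) (by omega)
  set K := β * Jz with hK
  have hK0 : 0 ≤ K := mul_nonneg hβ hz
  have hdom : ∀ y ∈ A, ∀ z ∈ A, onStrand J s (y, z) ≤ chainCoupling N K (τ y, τ z) := by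
    intro y _ z _
    by_cases h0 : onStrand J s (y, z) = 0
    · rw [h0]; exact chainCoupling_nonneg hK0 _
    · obtain ⟨-, -, h2, hval⟩ := onStrand_layeredXYCoupling_ne_zero h0
      rw [hval]
      -- the images are adjacent in the reference chain
      have hyv := hτval y
      have hzv := hτval z
      have hadj : ((τ y : ℕ) + 1 = (τ z : ℕ)) ∨ ((τ z : ℕ) + 1 = (τ y : ℕ)) := by omega
      have hle : (τ y : ℕ) ≤ N := Nat.lt_succ_iff.1 (τ y).2
      have hle' : (τ z : ℕ) ≤ N := Nat.lt_succ_iff.1 (τ z).2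
      unfold chainCoupling chainSegCoupling
      rw [if_pos (by rcases hadj with h | h <;> [left; right] <;> exact ⟨Nat.zero_le _, h, by assumption⟩)]
      exact le_of_eq (by rw [hK]; ring)
  have hsupp : ∀ p, onStrand J s p ≠ 0 → p.1 ∈ A ∧ p.2 ∈ A := fun p hp0 => by
    have hcond : strand p.1 = s ∧ strand p.2 = s := by by_contra hh; exact hp0 (if_neg hh)
    simpa [hA] using hcond
  have ha : a ∈ A := by simp [hA, hs]
  have hJs0 : ∀ p, 0 ≤ onStrand J s p := fun p => by
    unfold onStrand; split_ifs; exacts [hJ0 p, le_rfl]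
  -- compare term by term, then extend the sum to the whole reference chain
  calc ∑ x ∈ A, twoPoint (onStrand J s) a x
      ≤ ∑ x ∈ A, twoPoint (chainCoupling N K) (τ a) (τ x) := Finset.sum_le_sum fun x hx =>
          twoPoint_le_of_injOn hJs0 hsupp τ hinj (chainCoupling_nonneg hK0) hdom ha hx
    _ = ∑ i ∈ A.image τ, twoPoint (chainCoupling N K) (τ a) i := (Finset.sum_image hinj).symm
    _ ≤ ∑ i, twoPoint (chainCoupling N K) (τ a) i :=
          Finset.sum_le_sum_of_subset_of_nonneg (Finset.subset_univ _) fun i _ _ =>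
            twoPoint_nonneg (chainCoupling_nonneg hK0) _ _
    _ ≤ (1 + besselRatio K) / (1 - besselRatio K) := sum_twoPoint_chain_le hK0 (τ a)

/-- **The quasi-one-dimensional ordering criterion for the classical XY chain array, explicit form.** For
`β, J⊥, J∥ ≥ 0`, every finite `Λ ⊂ ℤ³` (free boundary conditions) and all `a, c ∈ Λ`, with `u = I₁(βJ∥)/I₀(βJ∥)`:

  `⟨cos(θ_a − θ_c)⟩_{Λ; chains J∥ along the axis, J⊥ across} ≤ (2βJ⊥ · (1+u)/(1−u))^{|a₀−c₀|+|a₁−c₁|}`.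

Hence NO long-range order in the array at any temperature `T` with `2(J⊥/T)(1+u(J∥/T))/(1−u(J∥/T)) < 1` —
`k_BT_c^{q1D-XY}(J∥,J⊥) ≤ T₀(J∥,J⊥)`, the root of that equation, `T₀ ~ 2√2·√(J∥J⊥)` as `J⊥/J∥ → 0` (Scalapino–Imry–
Pincus scaling, one-sided). `twoPoint_layered_le_pow_transverse` with `χ = (1+u)/(1−u)` (`sum_twoPoint_onStrand_le`).
[cite: AizenmanSimon1980LocalWard, Thm 3.2 and Remark 4 (mass gap by iteration of a local inequality)] -/
theorem twoPoint_layered_le_pow_transverse_besselRatio (hβ : 0 ≤ β) (hp : 0 ≤ Jp) (hz : 0 ≤ Jz)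
    (Λ : Finset (Site 3)) (a c : Λ) :
    twoPoint (layeredXYCoupling β Jp Jz Λ) a c ≤
      (2 * (β * Jp) * ((1 + besselRatio (β * Jz)) / (1 - besselRatio (β * Jz)))) ^ strandDist a c :=
  twoPoint_layered_le_pow_transverse hβ hp hz Λ (fun a' => sum_twoPoint_onStrand_le hβ hp hz Λ a') a c

/-! ### Closed form with Amos' bound `u(K) ≤ K/√(K² + 4)`: a `norm_num`-decidable criterion -/

omit [MeasurableSpace Circle] [BorelSpace Circle] in
/-- **Closed-form majorant of the chain susceptibility factor**: `(1 + u(K))/(1 − u(K)) ≤ (√(K²+4) + K)²/4` for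
`K ≥ 0` — Amos' bound `u(K) ≤ K/√(K²+4)` (tree `besselRatio_le`) pushed through the increasing map
`u ↦ (1+u)/(1−u)`, and `(1 + K/s)/(1 − K/s) = (s+K)/(s−K) = (s+K)²/4` for `s = √(K²+4)` (`s² − K² = 4`). The right
side is `~ K²` (not the true `~ 4K`) as `K → ∞`, so this form is for moderate `K = J∥/T` (at `J⊥/J∥ = 0.03` it moves
the root `T₀` by `≈ 3 %`). [cite: Amos1974, (11) p. 241] -/
theorem one_add_besselRatio_div_le {K : ℝ} (hK : 0 ≤ K) :
    (1 + besselRatio K) / (1 - besselRatio K) ≤ (Real.sqrt (K ^ 2 + 4) + K) ^ 2 / 4 := by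
  have hsq4 : Real.sqrt 4 = 2 := by
    rw [show (4 : ℝ) = 2 ^ 2 by norm_num, Real.sqrt_sq (by norm_num : (0 : ℝ) ≤ 2)]
  rcases hK.eq_or_lt with h | h
  · rw [← h, besselRatio_zero]
    norm_num [hsq4]
  · set s := Real.sqrt (K ^ 2 + 4) with hs
    have hs2 : s ^ 2 = K ^ 2 + 4 := Real.sq_sqrt (by positivity)
    have hs0 : 0 < s := Real.sqrt_pos.2 (by positivity)
    have hKs : K < s := by nlinarith [hs2, hs0, h]
    have h4 : (s + K) * (s - K) = 4 := by nlinarith [hs2]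
    set u := besselRatio K with hu
    have hu0 : 0 ≤ u := besselRatio_nonneg hK
    have hu1 : u < 1 := besselRatio_lt_one hK
    have huv : u ≤ K / s := besselRatio_le h
    have hv1 : K / s < 1 := by rw [div_lt_one hs0]; exact hKs
    calc (1 + u) / (1 - u) ≤ (1 + K / s) / (1 - K / s) := by
          rw [div_le_div_iff₀ (by linarith) (by linarith)]
          nlinarith [huv, hu0, hv1]
      _ = (s + K) / (s - K) := by
          have hsK : s - K ≠ 0 := by linarith
          field_simp
      _ = (s + K) ^ 2 / 4 := by
          have hsK : s - K ≠ 0 := by linarith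
          rw [div_eq_div_iff hsK (by norm_num : (4 : ℝ) ≠ 0)]
          have h5 : (s + K) ^ 2 * (s - K) = (s + K) * 4 := by rw [← h4]; ring
          linarith [h5]

/-- **The quasi-one-dimensional criterion in closed form** (Amos): for `β, J⊥, J∥ ≥ 0`, every finite `Λ ⊂ ℤ³` and all
`a, c ∈ Λ`,
`⟨cos(θ_a − θ_c)⟩_Λ ≤ (2βJ⊥ · (√((βJ∥)² + 4) + βJ∥)²/4)^{|a₀−c₀|+|a₁−c₁|}` — no Bessel function left. Reading: no order in
the chain array at `T` whenever `(J⊥/2T)(√((J∥/T)² + 4) + J∥/T)² < 1`; root `T₀^{A} ≥ T₀` within a few per cent of the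
Bessel-ratio root for `J⊥/J∥ ≳ 10⁻²` (`0.433·J∥` vs `0.421·J∥` at `J⊥/J∥ = 0.03`), degrading to `(2J∥²J⊥)^{1/3}`
scaling for very small `J⊥/J∥`. [cite: Amos1974, (11) p. 241] -/
theorem twoPoint_layered_le_pow_transverse_amos (hβ : 0 ≤ β) (hp : 0 ≤ Jp) (hz : 0 ≤ Jz) (Λ : Finset (Site 3))
    (a c : Λ) :
    twoPoint (layeredXYCoupling β Jp Jz Λ) a c ≤
      (2 * (β * Jp) * ((Real.sqrt ((β * Jz) ^ 2 + 4) + β * Jz) ^ 2 / 4)) ^ strandDist a c := by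
  have hK : 0 ≤ β * Jz := mul_nonneg hβ hz
  have hχ0 : 0 ≤ (1 + besselRatio (β * Jz)) / (1 - besselRatio (β * Jz)) :=
    div_nonneg (by linarith [besselRatio_nonneg hK]) (by linarith [besselRatio_lt_one hK])
  refine (twoPoint_layered_le_pow_transverse_besselRatio hβ hp hz Λ a c).trans ?_
  exact pow_le_pow_left₀ (mul_nonneg (by positivity) hχ0)
    (mul_le_mul_of_nonneg_left (one_add_besselRatio_div_le hK) (by positivity)) _

/-- **Row-ready form with a rational square-root majorant**: if `r ≥ 0` and `(βJ∥)² + 4 ≤ r²` then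
`⟨cos(θ_a − θ_c)⟩_Λ ≤ (2βJ⊥ · (r + βJ∥)²/4)^{|a₀−c₀|+|a₁−c₁|}`; for rational `β, J∥, J⊥, r` the decay condition
`2βJ⊥(r + βJ∥)²/4 < 1` is a `norm_num` fact (the cell's kernel-decimal grammar). [cite: Amos1974, (11) p. 241] -/
theorem twoPoint_layered_le_pow_transverse_of_sq_le (hβ : 0 ≤ β) (hp : 0 ≤ Jp) (hz : 0 ≤ Jz)
    (Λ : Finset (Site 3)) {r : ℝ} (hr : 0 ≤ r) (hr2 : (β * Jz) ^ 2 + 4 ≤ r ^ 2) (a c : Λ) :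
    twoPoint (layeredXYCoupling β Jp Jz Λ) a c ≤
      (2 * (β * Jp) * ((r + β * Jz) ^ 2 / 4)) ^ strandDist a c := by
  have hK : 0 ≤ β * Jz := mul_nonneg hβ hz
  have hsr : Real.sqrt ((β * Jz) ^ 2 + 4) ≤ r := by
    rw [← Real.sqrt_sq hr]
    exact Real.sqrt_le_sqrt hr2
  refine (twoPoint_layered_le_pow_transverse_amos hβ hp hz Λ a c).trans ?_
  refine pow_le_pow_left₀ (by positivity) (mul_le_mul_of_nonneg_left ?_ (by positivity)) _
  have h0 : 0 ≤ Real.sqrt ((β * Jz) ^ 2 + 4) + β * Jz := by positivity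
  exact div_le_div_of_nonneg_right (pow_le_pow_left₀ h0 (by linarith) 2) (by norm_num)

end Quasi1D

end PlaneRotator

end Literature.Probability.LatticeModels
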